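import Summits.QuantumFields.YangMills.Theorems.VirialFluxGapValleyCombParametrisation
import HarnessLib

/-!
# Route `VirialFluxGap` (YangMills): the COMB-FLAT FAMILY of ring histories is flat — explicit curves inside the toron valley

Companion of ✓`RegularValley.ringDeficit_eq_zero_iff_comb` (crux ⟨stmt-QuantumFields-24141⟩): the converse direction in directly usable form.
For EVERY gauge field `t` and every commuting quadruple (`h' : Fin 3 → SU2` pairwise commuting, `c'` commuting with the `h' k`) the ring history
`R(t, h', c') = (every slice = t⁻¹·combFlat h', seam x ↦ (t x)⁻¹ c' (t x))` has `F₀ = 0` (★ `ringDeficit_combRing_eq_zero`).  Consequently every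
one-parameter modification of the data inside the common centraliser stays in the valley (`ringDeficit_combRing_mul_eq_zero`: replace `h' k₀` by
`h' k₀ · u` with `u` commuting with all `h' k` and with `c'`; `ringDeficit_combRing_seam_mul_eq_zero`: replace `c'` by `c' · u`), and so does every
change of the gauge field `t` — these are the curves INSIDE `{F₀ = 0}` whose tangents span the kernel of the Hessian at a regular flat ring history
(the `m` approximate-kernel vectors of fcl-p3 g40's ✓`ResolventField.trace_resolvent_le`; `6` of them on the reduced group `X_fix`).

HONEST FRAMING: bookkeeping; ⟨24141⟩ stays OPEN; the Yang–Mills mass gap is NOT proved; no summit is proved by a line.  ROUTE-INDEPENDENT.  THEOREMS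
ONLY (no definition, no `sorry`), standard axioms.  Width seat `ym-line-sfw-p2-w2` g51, `--supports stmt-QuantumFields-24141`.
References: [cite: Luscher1983, §2].
-/

set_option autoImplicit false

noncomputable section

open scoped Quaternion Matrix BigOperators
open Literature.MathematicalPhysics.QuantumFieldTheory hiding SU2
open Literature.MathematicalPhysics.QuantumLattice

namespace Summit.QuantumFields.YangMills.Theorems.VirialFluxGap.RegularValley

open Summit.QuantumFields.YangMills.Theorems.FemtoTransferGap
open Summit.QuantumFields.YangMills.Theorems.FemtoTransferGap.TT
open Summit.QuantumFields.YangMills.Theorems.FemtoTransferGap.TwoLattice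
open Summit.QuantumFields.YangMills.Theorems.FemtoTransferGap.TwoLattice.Flat
open Summit.QuantumFields.YangMills.Theorems.VirialFluxGap.RingDeficit
open Summit.QuantumFields.YangMills.Theorems.ToronValleyVolume.Lojasiewicz

variable {L : ℕ} [NeZero L]

/-- ★ **The comb-flat ring of commuting data is flat**: `F₀(R(t, h', c')) = 0`. [cite: Luscher1983, §2] -/
theorem ringDeficit_combRing_eq_zero (t : Site 3 L → SU2) {h' : Fin 3 → SU2} {c' : SU2}
    (hh'c : ∀ i j, h' i * h' j = h' j * h' i) (hc'h : ∀ k, c' * h' k = h' k * c') :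
    ringDeficit L (fun _ => false)
      ((fun _ => gaugeTransform t⁻¹ (combFlat h')), fun x => (t x)⁻¹ * c' * t x) = 0 := by
  rw [ringDeficit_eq_sums, twist3_false]
  dsimp only
  have hSF : wilsonAction su2Rep (combFlat h' : GaugeConfig 3 L SU2) = 0 := wilsonAction_combFlat_eq_zero hh'c
  have hseamQ : gaugeTransform (fun x => (t x)⁻¹ * c' * t x) (gaugeTransform t⁻¹ (combFlat h')) =
      gaugeTransform t⁻¹ (combFlat h' : GaugeConfig 3 L SU2) := by
    rw [gaugeTransform_gaugeTransform]
    have e1 : ((fun x => (t x)⁻¹ * c' * t x) * t⁻¹ : Site 3 L → SU2) = t⁻¹ * fun _ => c' := by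
      funext x; simp only [Pi.mul_apply, Pi.inv_apply, mul_inv_cancel_right]
    rw [e1, ← gaugeTransform_gaugeTransform, gaugeTransform_const_combFlat_of_comm hc'h]
  rw [hseamQ, timeCoupling_deficit_self, wilsonAction_gaugeTransform, hSF]
  simp

/-- Modifying one wrap datum inside the common centraliser keeps the quadruple commuting. [folklore] -/
theorem comm_update_of_centraliser {h' : Fin 3 → SU2} {c' u : SU2} (hh'c : ∀ i j, h' i * h' j = h' j * h' i)
    (hc'h : ∀ k, c' * h' k = h' k * c') (huh : ∀ k, u * h' k = h' k * u) (huc : u * c' = c' * u) (k₀ : Fin 3) :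
    (∀ i j, Function.update h' k₀ (h' k₀ * u) i * Function.update h' k₀ (h' k₀ * u) j =
        Function.update h' k₀ (h' k₀ * u) j * Function.update h' k₀ (h' k₀ * u) i) ∧
      ∀ k, c' * Function.update h' k₀ (h' k₀ * u) k = Function.update h' k₀ (h' k₀ * u) k * c' := by
  constructor
  · intro i j
    by_cases hi : i = k₀ <;> by_cases hj : j = k₀
    · subst hi; subst hj; rfl
    · subst hi
      rw [Function.update_self, Function.update_of_ne hj]
      calc h' i * u * h' j = h' i * (u * h' j) := by rw [mul_assoc]
        _ = h' i * (h' j * u) := by rw [huh j]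
        _ = h' j * h' i * u := by rw [← mul_assoc, hh'c i j]
        _ = h' j * (h' i * u) := by rw [mul_assoc]
    · subst hj
      rw [Function.update_self, Function.update_of_ne hi]
      calc h' i * (h' j * u) = h' i * h' j * u := by rw [mul_assoc]
        _ = h' j * h' i * u := by rw [hh'c i j]
        _ = h' j * (h' i * u) := by rw [mul_assoc]
        _ = h' j * (u * h' i) := by rw [huh i]
        _ = h' j * u * h' i := by rw [← mul_assoc]
    · rw [Function.update_of_ne hi, Function.update_of_ne hj]; exact hh'c i j
  · intro k
    by_cases hk : k = k₀
    · subst hk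
      rw [Function.update_self]
      calc c' * (h' k * u) = c' * h' k * u := by rw [mul_assoc]
        _ = h' k * c' * u := by rw [hc'h k]
        _ = h' k * (c' * u) := by rw [mul_assoc]
        _ = h' k * (u * c') := by rw [huc]
        _ = h' k * u * c' := by rw [← mul_assoc]
    · rw [Function.update_of_ne hk]; exact hc'h k

/-- ★ **Wrap curves inside the valley**: for `u` in the common centraliser of the commuting data, the comb-flat ring with `h' k₀` replaced by
`h' k₀ · u` is flat (take `u = u(s)` a one-parameter subgroup of the common maximal torus: a curve in `{F₀ = 0}`). [cite: Luscher1983, §2] -/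
theorem ringDeficit_combRing_update_eq_zero (t : Site 3 L → SU2) {h' : Fin 3 → SU2} {c' u : SU2}
    (hh'c : ∀ i j, h' i * h' j = h' j * h' i) (hc'h : ∀ k, c' * h' k = h' k * c') (huh : ∀ k, u * h' k = h' k * u) (huc : u * c' = c' * u)
    (k₀ : Fin 3) :
    ringDeficit L (fun _ => false)
      ((fun _ => gaugeTransform t⁻¹ (combFlat (Function.update h' k₀ (h' k₀ * u)))), fun x => (t x)⁻¹ * c' * t x) = 0 := by
  obtain ⟨h1, h2⟩ := comm_update_of_centraliser hh'c hc'h huh huc k₀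
  exact ringDeficit_combRing_eq_zero t h1 h2

/-- ★ **Seam curves inside the valley**: replacing `c'` by `c' · u` with `u` commuting with the wraps keeps the comb-flat ring flat. [cite: Luscher1983, §2] -/
theorem ringDeficit_combRing_seam_mul_eq_zero (t : Site 3 L → SU2) {h' : Fin 3 → SU2} {c' u : SU2}
    (hh'c : ∀ i j, h' i * h' j = h' j * h' i) (hc'h : ∀ k, c' * h' k = h' k * c') (huh : ∀ k, u * h' k = h' k * u) :
    ringDeficit L (fun _ => false)
      ((fun _ => gaugeTransform t⁻¹ (combFlat h')), fun x => (t x)⁻¹ * (c' * u) * t x) = 0 := by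
  refine ringDeficit_combRing_eq_zero t hh'c fun k => ?_
  calc c' * u * h' k = c' * (u * h' k) := by rw [mul_assoc]
    _ = c' * (h' k * u) := by rw [huh k]
    _ = c' * h' k * u := by rw [← mul_assoc]
    _ = h' k * c' * u := by rw [hc'h k]
    _ = h' k * (c' * u) := by rw [mul_assoc]

/-- ★ **Gauge curves inside the valley**: the comb-flat family is flat for EVERY gauge field `t`, in particular along `s ↦ t·γ(s)` for any curve
`γ` of gauge fields (the `3L³`-dimensional gauge directions of the kernel; on `X_fix` only the constant ones survive). [cite: Luscher1983, §2] -/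
theorem ringDeficit_combRing_gauge_mul_eq_zero (t γ : Site 3 L → SU2) {h' : Fin 3 → SU2} {c' : SU2}
    (hh'c : ∀ i j, h' i * h' j = h' j * h' i) (hc'h : ∀ k, c' * h' k = h' k * c') :
    ringDeficit L (fun _ => false)
      ((fun _ => gaugeTransform (t * γ)⁻¹ (combFlat h')), fun x => ((t * γ) x)⁻¹ * c' * (t * γ) x) = 0 :=
  ringDeficit_combRing_eq_zero (t * γ) hh'c hc'h

end Summit.QuantumFields.YangMills.Theorems.VirialFluxGap.RegularValley

end
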